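import Summits.QuantumFields.YangMills.Theorems.FradkinShenkerFlowSusceptibilityToPoincareTwoBlockFactorization
import Summits.QuantumFields.YangMills.Theorems.FradkinShenkerFlowSusceptibilityToPoincareBoxDecouplingOfHMC
import Summits.QuantumFields.YangMills.Theorems.FradkinShenkerFlowSusceptibilityToPoincareLocalPoincareSmallCylinders
import Summits.QuantumFields.YangMills.Theorems.FradkinShenkerFlowSusceptibilityToPoincareBisection

/-!
# HMC ⇒ UP: hierarchical one-scale maximal correlation gives the uniform heat-bath Poincaré inequality
(line `maxcorr-halving` of crux `SusceptibilityToPoincare`, route `FradkinShenkerFlow` of `YangMills`, item `stmt-QuantumFields-9441`)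

This file composes the four landed provable stubs of the registered skeleton
`Cruxes/SusceptibilityToPoincare/Lines/maxcorr-halving.lean` — C1 `stub_twoBlockFactorization` (p77169), C2
`stub_boxDecoupling_of_hmc` (p81511), C3 `stub_localPoincare_smallCylinders` (p85508), C4 `stub_bisection` (p81397) —
into the PROVABLE HALF of the line, stated over tree declarations only (no vocabulary `def`):

* `up_of_hmc` — for EVERY compact group `G`, lattice representation `r` and real `β`: if the torus Wilson measures
  `wilsonMeasure r.ρ β` satisfy the hierarchical one-scale maximal-correlation bound (HMC: some thickness `R ≥ 1` and
  `ρ < 1` such that for every cylinder `Q` of every torus, conditionally on all links outside `Q`, an `R`-slab of `Q` and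
  the links of `Q` at torus-distance `≥ R` from it have maximal correlation `≤ ρ`, as an integrated `L²` inequality of
  conditional expectations w.r.t. `cylinderEvents`), then they satisfy the UNIFORM single-link heat-bath Poincaré
  inequality (UP) — verbatim the conclusion of the crux — with a constant independent of the volume.
  Proof: Martinelli's bisection `stub_bisection` fed with the two-block factorisation `stub_twoBlockFactorization`, the
  box decoupling `stub_boxDecoupling_of_hmc` and the small-cylinder base `stub_localPoincare_smallCylinders`.
* `susceptibilityToPoincare_of_hmc_of_fs` — consequently the crux `SusceptibilityToPoincare` (FS ⇒ UP for compact simple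
  `G`, `β ≥ 0`) follows from the single implication "FS ⇒ HMC" for compact simple `G`, `β ≥ 0` (the line's open stubs
  A1 ∘ A2/A3): the crux is REDUCED to a static one-scale decorrelation statement.

Sources for the architecture: Martinelli, Saint-Flour 1997 (LNM 1717) Thm 4.5; Martinelli–Olivieri, CMP 161 (1994);
Cesi, PTRF 120 (2001).  Everything here is a theorem; no named fact is assumed.
-/

noncomputable section

open MeasureTheory ProbabilityTheory
open Literature.MathematicalPhysics.QuantumFieldTheory

namespace Summit.QuantumFields.YangMills.Theorems.SusceptibilityToPoincare

/-- **HMC ⇒ UP** (line `maxcorr-halving`, provable half, composed from the landed stubs C1–C4): for every compact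
group `G`, lattice representation `r` and real `β`, the hierarchical one-scale maximal-correlation hypothesis for the torus
Wilson measures implies the uniform single-link heat-bath Poincaré inequality with a volume-independent constant.
(Martinelli 1999, Thm 4.5, in maximal-correlation currency.) -/
theorem up_of_hmc :
    ∀ (G : Type) [Group G] [TopologicalSpace G] [IsTopologicalGroup G] [CompactSpace G]
      [MeasurableSpace G] [BorelSpace G] (r : LatticeRep G) (β : ℝ),
      (∃ R : ℕ, 1 ≤ R ∧ ∃ ρ : ℝ, 0 ≤ ρ ∧ ρ < 1 ∧ ∀ (S : ℕ) (μW : Measure (GaugeConfig 4 (2 * S + 1) G)),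
        μW = (wilsonMeasure r.ρ β : Measure (GaugeConfig 4 (2 * S + 1) G)) →
        ∀ (a : Fin 4 → ZMod (2 * S + 1)) (n : Fin 4 → ℕ), (∀ ν, n ν ≤ 2 * S + 1) →
        ∀ (Q : Set (Site 4 (2 * S + 1))), Q = {x | ∀ ν, (x ν - a ν).val < n ν} →
        ∀ (K : Set (Edge 4 (2 * S + 1))), K = {ℓ | ℓ.1 ∉ Q} →
        ∀ (i : Fin 4) (c : ℕ), (n i ≤ 2 * S → c + R ≤ n i) →
        ∀ (X : Set (Edge 4 (2 * S + 1))), X = {ℓ | ℓ.1 ∈ Q ∧ (ℓ.1 i - a i - (c : ZMod (2 * S + 1))).val < R} →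
        ∀ (Z : Set (Edge 4 (2 * S + 1))),
          Z = {ℓ | ℓ.1 ∈ Q ∧ 3 * R ≤ (ℓ.1 i - a i - (c : ZMod (2 * S + 1)) + (R : ZMod (2 * S + 1))).val} →
        ∀ f : GaugeConfig 4 (2 * S + 1) G → ℝ, Measurable f → (∃ M : ℝ, ∀ U, |f U| ≤ M) →
        ∫ U, (condExp (cylinderEvents (K ∪ X)) μW (condExp (cylinderEvents (K ∪ Z)) μW f) U
            - condExp (cylinderEvents K) μW f U) ^ 2 ∂μW ≤
          ρ ^ 2 * ∫ U, (f U - condExp (cylinderEvents K) μW f U) ^ 2 ∂μW) →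
      ∃ C : ℝ, ∀ S : ℕ, ∀ F : GaugeConfig 4 (2 * S + 1) G → ℝ, Measurable F → (∃ M : ℝ, ∀ U, |F U| ≤ M) →
        variance F (wilsonMeasure r.ρ β : Measure (GaugeConfig 4 (2 * S + 1) G)) ≤
          C * ∑ ℓ : Edge 4 (2 * S + 1), ∫ U, ∫ g, (F U - F (Function.update U ℓ g)) ^ 2
            ∂((haarProbability G).tilted (fun g' => -β * wilsonAction r.ρ (Function.update U ℓ g')))
            ∂(wilsonMeasure r.ρ β : Measure (GaugeConfig 4 (2 * S + 1) G)) :=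
  fun G _ _ _ _ _ _ r β hH =>
    stub_bisection G r β (stub_twoBlockFactorization G) (stub_boxDecoupling_of_hmc G r β hH)
      (stub_localPoincare_smallCylinders G r β)

/-- **The crux reduced to FS ⇒ HMC**: if for every compact simple `G`, faithful unitary `r` and `β ≥ 0` finite
gauge-invariant susceptibility (FS, verbatim the crux hypothesis) implies the hierarchical one-scale maximal-correlation
bound (HMC), then `SusceptibilityToPoincare` holds — by `up_of_hmc`. -/
theorem susceptibilityToPoincare_of_hmc_of_fs :
    (∀ (G : Type) [Group G] [TopologicalSpace G] [IsTopologicalGroup G] [CompactSpace G]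
      [MeasurableSpace G] [BorelSpace G], IsCompactSimpleLieGroup G →
      ∀ (r : LatticeRep G) (β : ℝ), 0 ≤ β →
      (∀ A B : YMSpecies G, ∃ χ : ℝ, ∀ S : ℕ, ∑ x ∈ Literature.Probability.LatticeModels.box 4 S,
        |covariance (fun U => A.F (Literature.MathematicalPhysics.QuantumLattice.torusLift (2 * S + 1) U))
          (fun U => B.F (Literature.MathematicalPhysics.QuantumLattice.configShift (-x)
          (Literature.MathematicalPhysics.QuantumLattice.torusLift (2 * S + 1) U)))
          (wilsonMeasure r.ρ β : Measure (GaugeConfig 4 (2 * S + 1) G))| ≤ χ) →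
      ∃ R : ℕ, 1 ≤ R ∧ ∃ ρ : ℝ, 0 ≤ ρ ∧ ρ < 1 ∧ ∀ (S : ℕ) (μW : Measure (GaugeConfig 4 (2 * S + 1) G)),
        μW = (wilsonMeasure r.ρ β : Measure (GaugeConfig 4 (2 * S + 1) G)) →
        ∀ (a : Fin 4 → ZMod (2 * S + 1)) (n : Fin 4 → ℕ), (∀ ν, n ν ≤ 2 * S + 1) →
        ∀ (Q : Set (Site 4 (2 * S + 1))), Q = {x | ∀ ν, (x ν - a ν).val < n ν} →
        ∀ (K : Set (Edge 4 (2 * S + 1))), K = {ℓ | ℓ.1 ∉ Q} →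
        ∀ (i : Fin 4) (c : ℕ), (n i ≤ 2 * S → c + R ≤ n i) →
        ∀ (X : Set (Edge 4 (2 * S + 1))), X = {ℓ | ℓ.1 ∈ Q ∧ (ℓ.1 i - a i - (c : ZMod (2 * S + 1))).val < R} →
        ∀ (Z : Set (Edge 4 (2 * S + 1))),
          Z = {ℓ | ℓ.1 ∈ Q ∧ 3 * R ≤ (ℓ.1 i - a i - (c : ZMod (2 * S + 1)) + (R : ZMod (2 * S + 1))).val} →
        ∀ f : GaugeConfig 4 (2 * S + 1) G → ℝ, Measurable f → (∃ M : ℝ, ∀ U, |f U| ≤ M) →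
        ∫ U, (condExp (cylinderEvents (K ∪ X)) μW (condExp (cylinderEvents (K ∪ Z)) μW f) U
            - condExp (cylinderEvents K) μW f U) ^ 2 ∂μW ≤
          ρ ^ 2 * ∫ U, (f U - condExp (cylinderEvents K) μW f U) ^ 2 ∂μW) →
    Summit.QuantumFields.YangMills.Theses.FradkinShenkerFlow.SusceptibilityToPoincare :=
  by
  intro h G _ _ _ _ _ _ hG r β hβ hFS
  exact up_of_hmc G r β (h G hG r β hβ hFS)

end Summit.QuantumFields.YangMills.Theorems.SusceptibilityToPoincare

end
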